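import Literature.Probability.LatticeModels.IsingDisorderLaplacian
import HarnessLib

/-!
# The Kadanoff–Ceva primitive on the frozen boundary: constancy along chains of boundary plaquettes

Topic `Literature/Probability/LatticeModels`. Chelkak–Hongler–Izyurov 2015, Prop. 3.6 (ii): the
primitive `H` of the spinor observable vanishes on the boundary of the (simply connected) discrete
domain — `H°` on boundary faces, `H•` on boundary vertices (after the boundary modification). In
the tree's Kadanoff–Ceva form (`IsingDisorderLaplacian.lean`) the local statement is
`hw_eq_of_frozen` (constancy of `Hw` along a frozen SIDE of a plaquette of the cut system). This
file adds the diagonal step and the chain form, reducing the global normalisation `Hw|_{∂} ≡ const`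
to a connectivity statement about boundary plaquettes:

* `IsKCPrimitive.hw_eq_of_frozen_corners`: two frozen corners of the SAME plaquette of the cut
  system carry the same value of `Hw` (both equal `Hb(p) - ⟨μ_{T_p} σ_B⟩²`, `hb_sub_hw_of_frozen`);
* `FrozenLinked` (two frozen sites are corners of a common plaquette of `P`) and
  **`IsKCPrimitive.hw_eq_of_frozenChain`**: `Hw` is constant along every chain of frozen sites
  consecutively linked through plaquettes of `P` (`List.Chain'`).

Everything is proved; no named fact.

## References

* D. Chelkak, C. Hongler, K. Izyurov, Ann. of Math. 181 (2015): Prop. 3.6 (ii), Prop. 2.4 (2.4)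
  [ChelkakHonglerIzyurovAnnals2015].
-/

noncomputable section

namespace Literature.Probability.LatticeModels

open Finset

variable {G₂ : SimpleGraph (Site 2)} [G₂.LocallyFinite]
variable {Λ : Finset (Site 2)} {β : ℝ} {η : SpinConfig (Site 2)} {B : Finset (Site 2)}
  {cut : Site 2 → Finset (Sym2 (Site 2))} {Hw Hb : Site 2 → ℝ} {P : Set (Site 2)}

/-- **Two frozen corners of one plaquette carry the same `Hw`.** [cite: ChelkakHonglerIzyurovAnnals2015, Prop. 3.6 (ii)] -/
theorem IsKCPrimitive.hw_eq_of_frozen_corners (h : IsKCPrimitive G₂ Λ β (.fixed η) B cut Hw Hb P)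
    {v v' : Site 2} {k k' : Fin 4} (hk : faceAt v k ∈ P) (hkk : faceAt v' k' = faceAt v k) (hv : v ∉ Λ) (hv' : v' ∉ Λ) :
    Hw v' = Hw v := by
  have e1 := h.hb_sub_hw_of_frozen hk hv
  have hk' : faceAt v' k' ∈ P := by rw [hkk]; exact hk
  have e2 := h.hb_sub_hw_of_frozen hk' hv'
  rw [hkk] at e2
  linarith

/-- **Linked frozen sites**: corners of a common plaquette of `P`. [folklore] -/
def FrozenLinked (P : Set (Site 2)) (v v' : Site 2) : Prop :=
  ∃ k k' : Fin 4, faceAt v k ∈ P ∧ faceAt v' k' = faceAt v k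

/-- **`Hw` is constant along chains of frozen sites linked through plaquettes of the cut system.** [cite: ChelkakHonglerIzyurovAnnals2015, Prop. 3.6 (ii)] -/
theorem IsKCPrimitive.hw_eq_of_frozenChain (h : IsKCPrimitive G₂ Λ β (.fixed η) B cut Hw Hb P) :
    ∀ (l : List (Site 2)) (v : Site 2), (∀ w ∈ v :: l, w ∉ Λ) → List.IsChain (FrozenLinked P) (v :: l) →
      ∀ w ∈ v :: l, Hw w = Hw v
  | [], v, _, _ => by simp
  | (u :: l), v, hfro, hch => by
    rw [List.isChain_cons_cons] at hch
    obtain ⟨⟨k, k', hk, hkk⟩, hch'⟩ := hch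
    have hv : v ∉ Λ := hfro v (by simp)
    have hu : u ∉ Λ := hfro u (by simp)
    have huv : Hw u = Hw v := h.hw_eq_of_frozen_corners hk hkk hv hu
    have ih := IsKCPrimitive.hw_eq_of_frozenChain h l u (fun w hw => hfro w (List.mem_cons_of_mem _ hw)) hch'
    intro w hw
    rcases List.mem_cons.1 hw with rfl | hw
    · rfl
    · rw [ih w hw, huv]

end Literature.Probability.LatticeModels
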